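import Mathlib
import HarnessLib
import HarnessLib.Audit
import Summits.AnomalousDissipation.Statement
import Literature.Analysis.FluidPDE.ClassicalSolution
import Literature.Analysis.FluidPDE.VectorCalculus
import Literature.Analysis.FunctionSpaces.SobolevDomain
import Summits.AnomalousDissipation.AnomalousDissipation.Theorems.CoherentStatesSteadyImpliesCoherent
import Summits.AnomalousDissipation.AnomalousDissipation.Theorems.CoherentStatesAssembly
import Summits.AnomalousDissipation.AnomalousDissipation.Theorems.CoherentStatesClassicalGlobalIsGlobalLerayHopf
import HarnessLib.Audit.Status.Attr

/-!
Route: PointSink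

DORMANT since 2026-09-01T22:04:19Z (reconciler: no traction for 5 d (last activity item-evidence-added at 2026-08-27T21:13:44Z); parked, not closed — `ledger route dormant route-AnomalousDissipation-PointSink --off` to reactivate) — unstaffed, not closed; items shared with open routes are served there. `ledger route dormant <id> --off` reactivates.

# Route PointSink — the Onsager-decay cascade soliton planted in T³ — the zeroth law carried by a
point energy sink

RESURRECTION (lens resurrect, cycle 2) of two UNFINISHED 2001 walls of the ns family —
`cascade-soliton` (ns-neg theory t1, prediction P1: a smooth steady unforced Navier–Stokes solution
Q on ℝ³ with the Onsager/Galdi-critical decay envelope |x|^{-2/3} and finite positive dissipation,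
fed from infinity by the Euler energy flux of its own far field) and `onsager-point-flux` (P5: a
(−2/3)-homogeneous steady weak Euler cone on ℝ³∖{0} with NONZERO energy flux through spheres) —
together with our own retired arena route HomogeneousForceArena (conical-dodger /
Liouville-at-infinity alternative, retired not-a-thesis because nothing transferred to T³). The
transfer is supplied here. The exact NS scaling u_ν(x) = ν μ Q(μ x) with μ = (A/ν)³ turns ONE
cascade soliton into an unforced steady family on ℝ³ whose dissipation ν∫|∇u_ν|² = A³∫|∇Q|² does not
depend on ν and whose energy in the unit ball stays bounded (the |x|^{-2/3} envelope is the unique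
decay for which both hold): the zeroth law at a point, in free space, fed from spatial infinity.
Planting it in T³ means feeding it instead by a smooth steady stirring away from the sink. It
suffices to show X = PointSinkZerothLaw: ONE smooth steady divergence-free mean-zero force f on T³,
a point x₀, viscosities ν_j → 0 and STEADY classical NS states (u_j, p_j) with ∫|u_j|² ≤ E,
ν_j‖∇u_j‖² ≥ ε > 0 and all the dissipation concentrating at x₀ (ν_j ∫_{dist(x,x₀) ≥ r} |∇u_j|² → 0
for every r > 0) — the steady crux SteadyZerothLaw (stmt-AnomalousDissipation-0219, CoherentStates
#2 / FrozenK41) refined by a point-concentration clause. X is reached by the chain of three cruxes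
PointFluxCone → CascadeSoliton → PointSinkZerothLaw: the Euler cone exists (rank 2: the killable
gate of the whole line), it desingularises to a soliton (rank 3: the hardest step), the soliton
transplants to T³ (rank 4).
Lean: `∃ f : UnitAddTorus (Fin 3) → EuclideanSpace ℝ (Fin 3),
Literature.Analysis.FunctionSpaces.Torus.IsSmooth f ∧
Literature.Analysis.FunctionSpaces.Torus.IsDivFree f ∧
Literature.Analysis.FunctionSpaces.Torus.HasZeroMean f ∧ ∃ (x₀ : UnitAddTorus (Fin 3)) (ν : ℕ → ℝ)
(u : ℕ → UnitAddTorus (Fin 3) → EuclideanSpace ℝ (Fin 3)) (p : ℕ → UnitAddTorus (Fin 3) → ℝ), (∀ j,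
0 < ν j) ∧ Filter.Tendsto ν Filter.atTop (nhds 0) ∧ (∀ j,
Literature.Analysis.FunctionSpaces.Torus.IsClassicalNSSolutionOn Set.univ (ν j) (fun _ => f) (fun _
=> u j) (fun _ => p j)) ∧ (∃ E : ℝ, ∀ j, MeasureTheory.integral MeasureTheory.volume (fun x => ‖u j
x‖ ^ 2) ≤ E) ∧ (∃ ε : ℝ, 0 < ε ∧ ∀ j, ε ≤ ν j * Literature.Analysis.FunctionSpaces.Torus.gradNormSq
(u j)) ∧ ∀ r : ℝ, 0 < r → Filter.Tendsto (fun j => ν j * ∫ x in {x : UnitAddTorus (Fin 3) | r ≤ dist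
x x₀}, ∑ i, ‖Literature.Analysis.FunctionSpaces.Torus.partialDeriv i (u j) x‖ ^ 2) Filter.atTop
(nhds 0)`

## Assembly
Pure logic plus landed glue. `closes (h₁ : PointFluxCone) (h₂ : ConeDesingularisation) (h₃ :
SolitonTransplant) : AnomalousDissipation` — h₃ (h₂ h₁) : PointSinkZerothLaw; drop the concentration
clause to get CoherentStates.SteadyZerothLaw (same binders, verbatim); apply the landed Theorems
steadyImpliesCoherent_proof (SteadyZerothLaw → CoherentThesis: time-constant fields are 1-periodic,
Cesàro means of constants), coherentStatesAssembly_proof and classicalGlobalIsGlobalLerayHopf_proof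
(classical global ⇒ Leray–Hopf, Robinson–Rodrigo–Sadowski Thm 6.5). Elaborated rc 0 in Sketch.lean;
all three cruxes are load-bearing binders; CascadeSoliton and PointSinkZerothLaw are the nodes they
connect.

Rationale: WHY THIS LINE. Mechanism: anomalous dissipation carried by ONE coherent object — an unforced steady
D-solution at the critical decay — instead of a statistical cascade; its ν-family is exact
(scaling), so ν-independence of the dissipation is an IDENTITY, not an estimate, and the summit
reduces to (a) existence of the object on ℝ³ and (b) an inner–outer gluing on T³ with a force we are
free to design. Four independent criticalities coincide at this one object and explain why every
rigidity theorem in print stops exactly there: the cone |x|^{-2/3} is (i) the only homogeneity with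
scale-free Euler energy flux through spheres (Shvydkoy arXiv:1510.03378 §6, Lemma 6.1: C¹ profiles
are fluxless; the conjecture p. 2), (ii) exactly Onsager-critical, ‖V(·+h)−V‖_{L³} ≍ |h|^{1/3}, i.e.
B^{1/3}_{3,∞} on the nose (Frisch1995 β-model with D = 0 gives h = −2/3), (iii) exactly the
borderline of every steady Liouville criterion — Galdi2011 Thm X.9.5 (L^{9/2}),
Kozono–Terasawa–Wakasugi JFA 272 (2017) (small weak-L^{9/2}; |ω| = o(|x|^{-5/3})), Chae–Wolf
arXiv:1604.07643 (log-L^{9/2}), Zhao 2019 and KTW arXiv:2208.03850 ((2/3)^+), Bang–Yang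
arXiv:2402.11144, Wang–Yang arXiv:2608.06040 Thm 1.5/1.6 (r^{-2/3} log^{-γ}, γ > 1/3: "exactly what
makes the cubic radial flux ∫ rH³ dr integrable", p. 5), Vergara-Hermosilla arXiv:2604.06527 — all
of which say "summable flux ⇒ trivial", while the soliton is DEFINED by constant flux, and (iv) the
degenerate endpoint p = 9/2 of De Rosa–Isett's intermittency barrier (arXiv:2212.08176 Thm 2.13 with
γ = 0). Imported areas: steady-NS Liouville/asymptotics technology (Galdi, Korolev–Šverák
arXiv:0711.0560 — exterior steady flows are asymptotically Landau, the degree −1 precedent of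
"viscous core + homogeneous tail" — Li–Li–Yan arXiv:1811.01089 and Kwon–Tsai 2021 for singular-ray
and discretely self-similar homogeneous NS profiles), homogeneous Euler analysis on S² (Luo–Shvydkoy
arXiv:1409.4322, Shvydkoy 2018, Abe arXiv:2305.05987: existence is known ONLY for degrees outside
[−2, 0]), stationary convex integration (Choffrut–Székelyhidi doi:10.1137/140957354, Huang
arXiv:2405.08390) for the flexible side of the cone crux, inner–outer gluing (Dávila–del
Pino–Musso–Wei arXiv:1803.00066) for the transplant. What no listed route does: the 39 open routes
either build the anomaly from unsteady/statistical objects (EulerLimit, Ensemble,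
MarginalStabilityChain, Sparks, DebrisQuanta — whose exponent map stops at α > 2/3, unsteady), from
steady structures without a point mechanism (CoherentStates, FrozenK41, SteadyWeakLimit,
TameDichotomy, MirrorVariety, WindLine), from forced degree −1 jets (LandauJetArena: point MOMENTUM
flux, NS-critical force), or use Liouville theorems on the NEGATIVE side (KolmogorovLiouville:
SubBallisticLiouville at h < 1 — a cascade soliton is precisely a "Kolmogorov state" at h = −2/3 in
its normalisation, so this route is its constructive dual; SteadySweep corpse). Cross-summit:
CascadeSoliton implies NavierStokesRegularity's open item NontrivialDSolutionExists
(stmt-NavierStokesRegularity-0898) and its pointwise subclass is negated by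
GaldiLiouvilleGate.CriticalRateLiouville (stmt-…-0897, open): the two summits now hold opposite ends
of Galdi's Liouville problem, and exactly one profits. No unpublished internal result is
load-bearing: the 2001 items enter AS cruxes (CRITIC `unpublished-internal-dependency`: none
assumed).

RANKED CRUXES. #0 PointSinkZerothLaw (target) — X — there are a smooth divergence-free mean-zero
steady force f on T³, a sink x₀ ∈ T³, viscosities ν_j > 0 with ν_j → 0 and steady classical
solutions (u_j, p_j) of NS_{ν_j} forced by f on all of ℝ × T³ (time-constant IsClassicalNSSolutionOn
univ) with ∫|u_j|² ≤ E, ε ≤ ν_j·gradNormSq(u_j) for some ε > 0, and point concentration of the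
dissipation: for every r > 0, ν_j ∫_{r ≤ dist(x,x₀)} Σ_i|∂_i u_j|² → 0. Dropping the last clause
gives CoherentStates.SteadyZerothLaw (stmt-0219) verbatim; `closes` does exactly that and then runs
the landed glue steadyImpliesCoherent_proof → coherentStatesAssembly_proof (+
classicalGlobalIsGlobalLerayHopf_proof). (why it might fail: A steady family burning ε in a ball of
radius ≍ ν³ needs |u| ≍ ν^{-2} at the sink and an exactly tuned inflow; steady branches at fixed
smooth f may always laminarise (εℓ/U³ ∼ Re⁻¹, Cheskidov2023 p.4) or delocalise their dissipation (De
Rosa–Isett-type intermittency costs).) [Cheskidov2023, BrueDeLellis2023, arXiv:2212.08176,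
DoeringFoias2002, Theses/CoherentStates.lean stmt-AnomalousDissipation-0219]
#2 PointFluxCone (crux) — POINT-FLUX CONE (2001 wall `onsager-point-flux`, generalised from
homogeneous to discretely self-similar): there are λ > 1, a measurable velocity V and a pressure P
on ℝ³∖{0}, self-similar of degrees (−2/3, −4/3) under x ↦ λx, with |V|² and P locally integrable off
the origin, solving the stationary Euler system weakly off the origin (all smooth compactly
supported vector tests supported off 0, pressure explicit; weakly divergence free), whose radial
energy-flux density (½|V|² + P)(V·x)/|x|² is integrable on the fundamental shell 1 < |x| < λ with
NON-ZERO integral (= log λ × the sphere flux when the flux is scale-independent). By Shvydkoy 2018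
Lemma 6.1 / 2001 P5-sheets the profile cannot be C¹ on S², nor bounded piecewise-C¹ (conical
sheets), nor axisymmetric with power-law poles: the witness must be genuinely rough (singular rays
at the L³-borderline blow-up dist^{-2/3}, Hölder profiles, or log-periodic DSS structure) — the
0-dimensional extreme of the stationary Onsager problem. Birth line: a strict DSS subsolution cone
with free flux parameter + dilation-equivariant stationary convex integration off the origin
(Choffrut–Székelyhidi / Huang schemes), the flux log-mean being continuous along the scheme.
[difficulty: XL] (why it might fail: Shvydkoy's transport identity v·∇H = (4/3)fH may extend to
every weak profile with integrable radial flux (¬W: rigidity), as it already does for C¹,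
conical-sheet and axisymmetric-pole profiles; CI schemes give L^∞-type profiles whose flux may be
forced to 0.) [arXiv:1510.03378, arXiv:1409.4322, arXiv:2305.05987, doi:10.1137/140957354,
arXiv:2405.08390, 2001 ns-neg theory-t1 WALL-REQUEST-2 and P5-sheets
(run/shared/lean/archive/2001/summits/ns-neg/theory/t1/work/),
Literature.Analysis.FluidPDE.shvydkoy_homogeneousSteadyEuler_alpha_one (tree, degree −1 analogue)]
#3 ConeDesingularisation (crux) — CONE DESINGULARISATION (2001 wall `cascade-soliton`, label W_dss ∪
W_hom, as an implication from the Euler object): if a point-flux cone exists (PointFluxCone) then a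
CASCADE SOLITON exists — a smooth steady solution (Q, P) of unit-viscosity Navier–Stokes on ℝ³
WITHOUT force, with the L²-mass envelope sup_{R ≥ 1} R^{-5/3}∫_{B_R}|Q|² < ∞ (the |x|^{-2/3} law in
flux-capacity form), finite non-zero dissipation 0 < ∫|∇Q|² < ∞, and a discretely self-similar far
field: some λ > 1 and a measurable, locally-L² (off 0), non-trivial V with V(λx) = λ^{-2/3}V(x) such
that λ^{-5k/3}∫_{λ^k<|x|<λ^{k+1}}|Q − V|² → 0. Intended line (birth skeleton Lines/birth.lean):
INVADING SPHERES — Leray's steady solutions in B_{λ^n} with the cone as boundary datum (inward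
kinetic-energy flux |Π|A³ through every sphere), a uniform Dirichlet bound, a NON-TRIVIALITY FLOOR
∫_{B_1}|∇Q_n|² ≥ d₀ pinned at unit scale by the scaling freedom Q ↦ μQ(μ·), far-field matching on
fixed shells; then local elliptic compactness n → ∞. By the energy identity the limit's dissipation
equals the inward flux of its far field, so the cone's Π ≠ 0 is what defeats triviality. Equivalent
reading: Galdi's Liouville problem FAILS in the critical L²-mass class (it implies
NavierStokesRegularity's NontrivialDSolutionExists, stmt-NavierStokesRegularity-0898). [deps:
PointFluxCone, CascadeSoliton] [difficulty: open-problem] (why it might fail: Consensus expects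
Liouville for all D-solutions: L^{9/2} (Galdi X.9.5), log-L^{9/2} (Chae–Wolf), o(r^{-5/3}) vorticity
(KTW), r^{-2/3}log^{-γ}, γ>1/3 (Wang–Yang 2026 Thm 1.5) all bite just inside; the invading-sphere
floor d₀ may decay like (log λ^n)^{-a} as the flux spreads over shells.) [Galdi2011,
arXiv:1604.07643, arXiv:1611.01563, arXiv:2208.03850, arXiv:2608.06040, arXiv:2402.11144,
arXiv:2604.06527, arXiv:0711.0560, arXiv:1811.01089, 2001 ns-neg theory-t1 WALL-REQUEST-1 and
THEORY.md §5 P1 (run/shared/lean/archive/2001/summits/ns-neg/theory/t1/work/),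
Theses/NavierStokesRegularity GaldiLiouvilleGate.lean stmt-NavierStokesRegularity-0897/0898]
#4 SolitonTransplant (crux) — SOLITON TRANSPLANT: if a cascade soliton exists then the point-sink
zeroth law X holds on T³. Intended construction (birth skeleton): (1) SINK COMPLETION — choose a
sink x₀, an amplitude A and a steady weak Euler field U ∈ L²(T³), equal to the rescaled cone A·V on
a punctured ball around x₀ and completed OUTSIDE it by a field of our design, with the smooth
stirring f := the Euler residual of the completion (smooth because the singular part is exactly
Euler near x₀ and its pressure gradient is Leray-projected away; the cone's roughness must be closed
up Euler-compatibly inside the stirring region — the geometric content); ∫ f·U = A³ × (cone flux) >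
0 is the anomalous work; (2) VISCOUS REALISATION — along the DSS viscosity sequence ν_k = A λ^{-k/3}
(so that μ_k = (A/ν_k)³ = λ^k matches the far-field period exactly) glue the exact soliton family
ν_k μ_k Q(μ_k(x − x₀)) into U and correct to exact steady NS_{ν_k} states by an inner–outer
Lyapunov–Schmidt scheme around a KNOWN core (the soliton's linearisation, modulo translations and
scaling) and a designed outer flow; dissipation ≥ A³∫|∇Q|²/2, energy ≤ 2∫|U|², concentration from
the core scaling. The force f is ν-independent by construction: it only sees the ν = 0 completed
field. [deps: CascadeSoliton, PointSinkZerothLaw] [difficulty: XL] (why it might fail: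
Constant-strength singular rays of the cone cannot end under a smooth f (Bernoulli pairing kills
C¹-off-a-point sinks; a rough completion must be Euler-compatible), and the outer linearised steady
Euler operator is not Fredholm: small-ν steady states near a designed Euler flow may not exist.)
[arXiv:1803.00066, arXiv:0711.0560, arXiv:1811.01089, doi:10.1137/140957354, arXiv:2405.08390,
Ideas/_closed/bernoulli-poincare-thin-set-liouville.md (card K1 SteadySkeletonNoWork: the
C¹-off-thin-set obstruction), Galdi2011 (Ch. IX steady existence in bounded domains),
Theses/HomogeneousForceArena.lean (retired corpse: the missing transfer)]
#9 CascadeSoliton (support) — NODE statement of the chain (the 2001 wall `cascade-soliton` verbatim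
in L²-mass form + DSS far field): ∃ smooth steady unforced unit-viscosity NS solution (Q, P) on ℝ³
with sup_{R≥1} R^{-5/3}∫_{B_R}|Q|² < ∞, 0 < ∫|∇Q|² < ∞, and a non-trivial measurable locally-L²
discretely self-similar far field V (V(λx) = λ^{-2/3}V(x)) with λ^{-5k/3}∫_{shell k}|Q − V|² → 0.
Filed as support so that it is a decl the two cruxes around it can name; proving it outright
discharges PointFluxCone and ConeDesingularisation at once (then `closes` needs only
SolitonTransplant). Its W_pt subclass (pointwise envelope with |∇Q| = O(r^{-5/3}), p → 0) is exactly
¬GaldiLiouvilleGate.CriticalRateLiouville on the NS summit. [difficulty: open-problem] [Galdi2011,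
arXiv:2608.06040, 2001 ns-neg theory-t1 WALL-REQUEST-1, Theses/NavierStokesRegularity
DSolutionBubble.lean stmt-NavierStokesRegularity-0898]
#9 FreeSpaceZerothLaw (support) — THE FREE-SPACE ZEROTH LAW (provable now, pure change of variables;
the sanity identity behind the whole line): for every C¹ field Q on ℝ³ with integrable |∇Q|² and the
envelope ∫_{B_R}|Q|² ≤ C R^{5/3} (R ≥ 1), and every 0 < ν ≤ 1, the rescaled field u_ν(y) = ν^{-2}
Q(ν^{-3} y) satisfies ν ∫ |∇u_ν|² = ∫ |∇Q|² (ν-INDEPENDENT dissipation) and ∫_{B_1}|u_ν|² ≤ C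
(bounded energy in the unit ball). With Q a steady NS solution at viscosity 1, u_ν is a steady NS
solution at viscosity ν (same scaling), so a cascade soliton IS a fixed-point zeroth-law family on
ℝ³ fed from infinity. ~150 lines: fderiv of y ↦ a•Q(b•y), frobeniusNormSq homogeneity,
MeasureTheory.integral_comp_smul, Measure.addHaar_ball scaling. [difficulty: provable-now]
[Frisch1995, DoeringFoias2002, Literature.Analysis.FluidPDE.IsSuitableWeakSolutionOn.stRescale (tree
covariance lemmas used by HomogeneousForceArena)]

TWO-LAYER PLAN. Foreseen glued splits (not filed now; each is the birth skeleton of the crux,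
published under Cruxes/<Decl>/Lines/birth.lean): ConeDesingularisation ⇐ InvadingSpheres
(PointFluxCone → uniformly bounded invading family with unit-scale floor) → EntireLimit (family →
CascadeSoliton, compactness); PointFluxCone ⇐ StrictSubsolutionCone → StationaryCIcone
(dilation-equivariant stationary convex integration with flux continuity); SolitonTransplant ⇐
SinkCompletion (Euler-level planting of the cone under a smooth stirring) → ViscousRealisation
(inner–outer gluing along ν_k = Aλ^{-k/3}). A provable support under ConeDesingularisation: the
soliton ENERGY–FLUX IDENTITY ∫|∇Q|² = lim_R −∮_{S_R}(P + ½|Q|²)Q·n (NSGaldi energy-equality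
technology in the tree).

KILL CRITERIA. (k1) PointFluxCone refuted — a rigidity theorem "every DSS weak Euler cone of degree
−2/3 with integrable radial flux density has zero flux log-mean" (Shvydkoy's Lemma 6.1 for weak
profiles) — kills the cone AND every soliton with self-similar far field: close
`refuted:PointFluxCone` (the refuting theorem is itself the ¬W wall of 2001 and a stationary-Onsager
landmark). (k2) A Liouville theorem in the L²-mass class (i″) (e.g. CriticalRateLiouville upgraded
from pointwise to (i″), or Wang–Yang's γ > 1/3 pushed to γ = 0) refutes CascadeSoliton ⇒
ConeDesingularisation is refuted unless PointFluxCone is false too; close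
`refuted:ConeDesingularisation` and hand the theorem to NavierStokesRegularity/GaldiLiouvilleGate.
(k3) A proof that no steady weak Euler field on T³ with smooth force can coincide with a
flux-carrying cone near a point (Euler-incompatibility of every rough cone) refutes
SinkCompletion-type lines; SolitonTransplant then needs a time-dependent core — pivot to a
Leray–Hopf (non-steady) target or close `refuted:SolitonTransplant`. (k4) SteadyNeg (stmt-0222)
proved anywhere refutes the target X (steady witnesses impossible) — close. (k5) kit evidence:
invading-sphere continuation with D(u_R) → 0 like R^{-a} ⇒ dormant.

NOT DECOMPOSED YET. No split of SolitonTransplant into completion/realisation ITEMS (they are stubs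
of its birth line; the nondegeneracy of the soliton's linearisation modulo the 4 symmetry directions
is a layer-2 hypothesis to be typed when a soliton candidate exists); no axisymmetric-with-swirl
sub-crux of PointFluxCone (the 2001 Part B computation pins axisymmetric poles at the borderline
exponent — a non-axisymmetric singular-ray configuration, WALL-REQUEST-2 lens L2, is the first
candidate, to be explored by a crux-ideate seat); no Leray–Hopf (unsteady-core) variant of X —
deliberately: steady states make `closes` three landed lines and keep X inside stmt-0219's staffing;
no definition requests (all notions inline: DSS scaling, weak Euler off the origin via
Literature.Analysis.FunctionSpaces.IsTestFunctionOn on the punctured space, torus concentration via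
the product metric `dist` on UnitAddTorus).

CHEAPEST FALSIFIER. PointFluxCone rigidity in the DSS-with-integrable-flux class: extend the
two-line proof of Shvydkoy 2018 Lemma 6.1 (test v·∇H = 2αfH against 1 on S²) to weak profiles for
which only f·H ∈ L¹(S²) is known — if the integration by parts survives (it needs H v ∈ L¹(S²), i.e.
|V|³ integrable on shells, which is MORE than the crux assumes), the crux dies exactly on the L³_loc
subclass and survives only on ray-type profiles with |V| ∉ L³_loc; a refuter can settle the L³_loc
subclass this week (lookup + 1 page), and a kit job (singular-ray shooting for the sphere system at
α = 2/3 with two or three non-coaxial rays, WALL-REQUEST-2 lenses L1/L2; or the invading-spheres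
continuation of card d-solution-bubble-gluing (o)) probes the rest. Not run by the planner this
cycle (no certified numerics set up; recorded as the first refuter task).

NUMBERS. Decay/degree: velocity −2/3, pressure/head −4/3, vorticity −5/3, L²-mass ∫_{B_R}|Q|² ≍
R^{5/3}, L³-mass ≍ R (log-divergent L^{9/2} and ∫ rH³dr: Wang–Yang 2026 p.5), Dirichlet integral
finite; ν-family u_ν = ν^{-2}Q(x/ν³): core radius ν³ (local Reynolds number |V|r/ν = r^{1/3}/ν = 1
at r = ν³), core speed ν^{-2}, dissipation A³∫|∇Q|² exactly, unit-ball energy ≤ C A²; Onsager: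
‖δ_hV‖_{L³} ≍ |h|^{1/3}; De Rosa–Isett threshold 2θ/(1−θ) > 9/p − 2 degenerates at p = 9/2;
Liouville frontier: L^{9/2} (Galdi X.9.5), |u| ≤ Cr^{-(2/3)^+} (Zhao 2019), r^{-2/3}log^{-γ}, γ >
1/3 (Wang–Yang Thm 1.5), L^{9/2+ε(x)} (Vergara-Hermosilla 2026); homogeneous Euler existence known
only for degree ∉ [−2, 0] (Abe 2024 Thms 1.1–1.5).

DEFINITION REQUESTS. None needed at open. Nice-to-have later (would shorten three signatures):
`Literature.Analysis.FluidPDE.IsSteadyWeakEulerOffOrigin V P` (weak stationary Euler on ℝ³∖{0} with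
explicit pressure) and `IsDiscretelySelfSimilar lam a V` — to be requested only if grounders ask.

Novelty: Searches (2026-08-17): `lit search --source zbmath "Liouville theorem stationary Navier-Stokes
equations decay" --year-from 2023` (4: KTW arXiv:2208.03850, Bang–Yang arXiv:2402.11144, Li–Luo JDE
2025, Wang–Zhou MHD); `lit read arXiv:2608.06040` (Wang–Yang 2026 Thm 1.5/1.6, Prop 1.4, p.5 read),
`lit read arXiv:2208.03850` (p.4: Zhao 2019 (2/3)^+ criteria), `lit search --source zbmath
"homogeneous solutions Euler equations stationary" --year-from 2014` (20: Shvydkoy 2018,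
Luo–Shvydkoy 2015/2017, Li–Li–Yan 2019, Abe 2024), `lit read arXiv:2305.05987 pp.1–4` (existence
only for degree ∉ [−2,0]; rigidity classes; LLY/Kwon–Tsai singular-ray and DSS NS profiles), `lit
search --source zbmath "Onsager conjecture stationary solutions"` (4), `lit search --source crossref
"weak solutions stationary incompressible Euler equations" --year-from 2012` (15:
Choffrut–Székelyhidi 2014, Huang 2024 arXiv:2405.08390 read Thm 1.1: L^∞ stationary CI with
sources), `lit search --source zbmath "stationary weak solutions Euler energy dissipation steady"`
(0 relevant), `lit galaxy search "anomalous dissipation" --star pdf` (20; De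
Rosa–Drivas–Inversi–Isett 2025 already vendored), `lit galaxy search … --star all` ×2 (0 substring
hits), openalex/s2/arxiv remote tiers rate-limited (429) — recorded; tree: `ledger negatives` (6,
none on steady D-solutions/cones), Ideas index (no card on cascade soliton / point flux; nearest
closed cards no-mass-sink-no-energy-sink → bernoulli-poincare-thin-set-liouville (NEG  [refs: 2208.03850, 2402.11144, 2608.06040, 2305.05987, 2405.08390, 1510.03378, 0711.0560, 1811.01089, Galdi2011]

Barriers (technique_class: anti-liouville d-solution, euler cone, inner-outer gluing): - technique_class: anti-liouville d-solution, euler cone, inner-outer gluing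
- Literature.Barriers.AnomalousDissipation.DeRosaDrivasInversi2024_thm12_bounded: APPLIES IN SPIRIT
(the limiting dissipation measure is a Dirac mass at x₀, space–time dimension 1 < 3) and is EVADED
BY NAME — the fact assumes L^∞ velocity families; the sink family has sup|u_ν| ≍ ν^{-2} and the
limit cone |U| ≍ dist^{-2/3} ∉ L^∞ (nor L^{9/2}).
- Literature.Barriers.AnomalousDissipation.DeRosaDrivasInversi2024_thm19_bounded: same escaping
hypothesis (boundedness); the support-dimension bound does not constrain unbounded sinks.
- Literature.Barriers.AnomalousDissipation.DeRosaIsett2024_thm213: consistent and SATURATED, not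
violated — with γ = 0 the condition reads 2θ/(1−θ) > 9/p − 2: at p = 3 it forbids uniform
L³B^θ_{3,∞} bounds for θ > 1/3 (the cone is exactly θ = 1/3), at p = 9/2 it forbids any θ > 0 — and
the family is unbounded in L^{9/2} itself (log-divergence of ∫|V|^{9/2}, the same logarithm as
Galdi's exponent); no uniform Besov bound is claimed anywhere in the route.
- Literature.Barriers.AnomalousDissipation.DeRosaDrivasInversiIsett2025_cor51: same reading
(concentration on an H^s-null set with the same exponent condition): saturated at p = 9/2, escaping
by unboundedness in L^p, p ≥ 9/2.
- Literature.Barriers.AnomalousDissipation.DeRosaInversi2024_thm12: BV ∩ L^∞ fields carry no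
Duchon–Robert dissipation — escaping hypothesis L^∞ again; the sink limit is not BV ∩ L^∞ near x₀.
- Literature.Bar

History (route lifecycle, newest last):
- 2026-08-27T12:22:27Z · rev 3: dropped PointFluxConeR — T1 sweep flag (i): PointFluxConeR is outside the closes cone (closes uses PointFluxCone/ConeDesingularisation/SolitonTransplant only); not load-bearing (operator:999:3109785)
- 2026-09-01T22:04:19Z · DORMANT — reconciler: no traction for 5 d (last activity item-evidence-added at 2026-08-27T21:13:44Z); parked, not closed — `ledger route dormant route-AnomalousDissipati (operator:999:3367281)

sub-problem: AnomalousDissipation · status: dormant · opened planner-plan-lens3-AnomalousDissipation-resurrect-g2-0 2026-08-17T03:14:21Z · rev 3 · ledger route-AnomalousDissipation-PointSink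
GENERATED by the gate from the ledger (D-0016/17). Provers cite these decls: `theorem foo : Summit.AnomalousDissipation.AnomalousDissipation.Theses.PointSink.<Decl> := …` in Summits/AnomalousDissipation/AnomalousDissipation/Theorems/<Name>.lean.
-/

namespace Summit.AnomalousDissipation.AnomalousDissipation.Theses.PointSink

open scoped BigOperators Topology Manifold Classical MeasureTheory ProbabilityTheory Matrix InnerProductSpace ComplexConjugate ContinuousMap
open Filter Set Function TopologicalSpace MeasureTheory

attribute [summit_statement] _root_.AnomalousDissipation

open Literature.Turb

/-- item stmt-AnomalousDissipation-19032 · target · rank 0 · open · by planner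
why it might fail: A steady family burning ε in a ball of radius ≍ ν³ needs |u| ≍ ν^{-2} at the sink and an exactly tuned inflow; steady branches at fixed smooth f may always laminarise (εℓ/U³ ∼ Re⁻¹, Cheskidov2023 p.4) or delocalise their dissipation (De Rosa–Isett-type intermittency costs).
sources: Cheskidov2023, BrueDeLellis2023, arXiv:2212.08176, DoeringFoias2002, Theses/CoherentStates.lean stmt-AnomalousDissipation-0219
[target] X — there are a smooth divergence-free mean-zero steady force f on T³, a sink x₀ ∈ T³,
viscosities ν_j > 0 with ν_j → 0 and steady classical solutions (u_j, p_j) of NS_{ν_j} forced by f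
on all of ℝ × T³ (time-constant IsClassicalNSSolutionOn univ) with ∫|u_j|² ≤ E, ε ≤
ν_j·gradNormSq(u_j) for some ε > 0, and point concentration of the dissipation: for every r > 0, ν_j
∫_{r ≤ dist(x,x₀)} Σ_i|∂_i u_j|² → 0. Dropping the last clause gives CoherentStates.SteadyZerothLaw
(stmt-0219) verbatim; `closes` does exactly that and then runs the landed glue
steadyImpliesCoherent_proof → coherentStatesAssembly_proof (+
classicalGlobalIsGlobalLerayHopf_proof). -/
@[route_item "route-AnomalousDissipation-PointSink"]
def PointSinkZerothLaw : Prop :=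
  ∃ f : UnitAddTorus (Fin 3) → EuclideanSpace ℝ (Fin 3), Literature.Analysis.FunctionSpaces.Torus.IsSmooth f ∧ Literature.Analysis.FunctionSpaces.Torus.IsDivFree f ∧ Literature.Analysis.FunctionSpaces.Torus.HasZeroMean f ∧ ∃ (x₀ : UnitAddTorus (Fin 3)) (ν : ℕ → ℝ) (u : ℕ → UnitAddTorus (Fin 3) → EuclideanSpace ℝ (Fin 3)) (p : ℕ → UnitAddTorus (Fin 3) → ℝ), (∀ j, 0 < ν j) ∧ Filter.Tendsto ν Filter.atTop (nhds 0) ∧ (∀ j, Literature.Analysis.FunctionSpaces.Torus.IsClassicalNSSolutionOn Set.univ (ν j) (fun _ => f) (fun _ => u j) (fun _ => p j)) ∧ (∃ E : ℝ, ∀ j, MeasureTheory.integral MeasureTheory.volume (fun x => ‖u j x‖ ^ 2) ≤ E) ∧ (∃ ε : ℝ, 0 < ε ∧ ∀ j, ε ≤ ν j * Literature.Analysis.FunctionSpaces.Torus.gradNormSq (u j)) ∧ ∀ r : ℝ, 0 < r → Filter.Tendsto (fun j => ν j * ∫ x in {x : UnitAddTorus (Fin 3) | r ≤ dist x x₀},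 ∑ i, ‖Literature.Analysis.FunctionSpaces.Torus.partialDeriv i (u j) x‖ ^ 2) Filter.atTop (nhds 0)

/-- item stmt-AnomalousDissipation-19033 · crux · rank 2 · closed · vacuous by Summit.AnomalousDissipation.AnomalousDissipation.Theorems.PointFluxCone_of @ 5497e8393cba (prover) · by planner
why it might fail: Shvydkoy's transport identity v·∇H = (4/3)fH may extend to every weak profile with integrable radial flux (¬W: rigidity), as it already does for C¹, conical-sheet and axisymmetric-pole profiles; CI schemes give L^∞-type profiles whose flux may be forced to 0.
sources: arXiv:1510.03378, arXiv:1409.4322, arXiv:2305.05987, doi:10.1137/140957354, arXiv:2405.08390, 2001 ns-neg theory-t1 WALL-REQUEST-2 and P5-sheets (run/shared/lean/archive/2001/summits/ns-neg/theory/t1/work/)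
[crux] POINT-FLUX CONE (2001 wall `onsager-point-flux`, generalised from homogeneous to discretely
self-similar): there are λ > 1, a measurable velocity V and a pressure P on ℝ³∖{0}, self-similar of
degrees (−2/3, −4/3) under x ↦ λx, with |V|² and P locally integrable off the origin, solving the
stationary Euler system weakly off the origin (all smooth compactly supported vector tests supported
off 0, pressure explicit; weakly divergence free), whose radial energy-flux density (½|V|² +
P)(V·x)/|x|² is integrable on the fundamental shell 1 < |x| < λ with NON-ZERO integral (= log λ ×
the sphere flux when the flux is scale-independent). By Shvydkoy 2018 Lemma 6.1 / 2001 P5-sheets the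
profile cannot be C¹ on S², nor bounded piecewise-C¹ (conical sheets), nor axisymmetric with
power-law poles: the witness must be genuinely rough (singular rays at the L³-borderline blow-up
dist^{-2/3}, Hölder profiles, or log-periodic DSS structure) — the 0-dimensional extreme of the
stationary Onsager problem. Birth line: a strict DSS subsolution cone with free flux parameter +
dilation-equivariant stationary convex integration off the origin (Choffrut–Székelyhidi / Huang
schemes), the flux log-mean bei -/
@[route_item "route-AnomalousDissipation-PointSink", crux]
def PointFluxCone : Prop :=
  ∃ (lam : ℝ) (V : EuclideanSpace ℝ (Fin 3) → EuclideanSpace ℝ (Fin 3)) (P : EuclideanSpace ℝ (Fin 3) → ℝ), 1 < lam ∧ MeasureTheory.AEStronglyMeasurable V MeasureTheory.volume ∧ (∀ x : EuclideanSpace ℝ (Fin 3), x ≠ 0 → V (lam • x) = lam ^ (-(2 / 3 : ℝ)) • V x) ∧ (∀ x : EuclideanSpace ℝ (Fin 3), x ≠ 0 → P (lam • x) = lam ^ (-(4 / 3 : ℝ)) * P x) ∧ MeasureTheory.LocallyIntegrableOn (fun x => ‖V x‖ ^ 2) {x : EuclideanSpace ℝ (Fin 3) | x ≠ 0} MeasureTheory.volume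 ∧ MeasureTheory.LocallyIntegrableOn P {x : EuclideanSpace ℝ (Fin 3) | x ≠ 0} MeasureTheory.volume ∧ (∀ φ : EuclideanSpace ℝ (Fin 3) → EuclideanSpace ℝ (Fin 3), Literature.Analysis.FunctionSpaces.IsTestFunctionOn ⟨{x : EuclideanSpace ℝ (Fin 3) | x ≠ 0}, isOpen_ne⟩ φ → ∫ x, (inner ℝ (V x) (fderiv ℝ φ x (V x)) + P x * Literature.Analysis.FluidPDE.VectorCalculus.divergence φ x) = 0) ∧ (∀ θ : EuclideanSpace ℝ (Fin 3) → ℝ, Literature.Analysis.FunctionSpaces.IsTestFunctionOn ⟨{x : EuclideanSpace ℝ (Fin 3) | x ≠ 0}, isOpen_ne⟩ θ → ∫ x, inner ℝ (V x) (gradient θ x) = 0) ∧ MeasureTheory.IntegrableOn (fun x => (‖V x‖ ^ 2 / 2 + P x) * (inner ℝ (V x) x / ‖x‖ ^ 2)) {x : EuclideanSpace ℝ (Fin 3) | 1 < ‖x‖ ∧ ‖x‖ < lam} MeasureTheory.volume ∧ (∫ x in {x : EuclideanSpace ℝ (Fin 3) | 1 < ‖x‖ ∧ ‖x‖ < lam},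 (‖V x‖ ^ 2 / 2 + P x) * (inner ℝ (V x) x / ‖x‖ ^ 2)) ≠ 0

/-- item stmt-AnomalousDissipation-19034 · crux · rank 3 · open · by planner
why it might fail: Consensus expects Liouville for all D-solutions: L^{9/2} (Galdi X.9.5), log-L^{9/2} (Chae–Wolf), o(r^{-5/3}) vorticity (KTW), r^{-2/3}log^{-γ}, γ>1/3 (Wang–Yang 2026 Thm 1.5) all bite just inside; the invading-sphere floor d₀ may decay like (log λ^n)^{-a} as the flux spreads over shells.
sources: Galdi2011, arXiv:1604.07643, arXiv:1611.01563, arXiv:2208.03850, arXiv:2608.06040, arXiv:2402.11144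
[crux] CONE DESINGULARISATION (2001 wall `cascade-soliton`, label W_dss ∪ W_hom, as an implication
from the Euler object): if a point-flux cone exists (PointFluxCone) then a CASCADE SOLITON exists —
a smooth steady solution (Q, P) of unit-viscosity Navier–Stokes on ℝ³ WITHOUT force, with the
L²-mass envelope sup_{R ≥ 1} R^{-5/3}∫_{B_R}|Q|² < ∞ (the |x|^{-2/3} law in flux-capacity form),
finite non-zero dissipation 0 < ∫|∇Q|² < ∞, and a discretely self-similar far field: some λ > 1 and
a measurable, locally-L² (off 0), non-trivial V with V(λx) = λ^{-2/3}V(x) such that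
λ^{-5k/3}∫_{λ^k<|x|<λ^{k+1}}|Q − V|² → 0. Intended line (birth skeleton Lines/birth.lean): INVADING
SPHERES — Leray's steady solutions in B_{λ^n} with the cone as boundary datum (inward kinetic-energy
flux |Π|A³ through every sphere), a uniform Dirichlet bound, a NON-TRIVIALITY FLOOR ∫_{B_1}|∇Q_n|² ≥
d₀ pinned at unit scale by the scaling freedom Q ↦ μQ(μ·), far-field matching on fixed shells; then
local elliptic compactness n → ∞. By the energy identity the limit's dissipation equals the inward
flux of its far field, so the cone's Π ≠ 0 is what defeats triviality. Equivalent reading: Galdi's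
Liouville problem FAILS in -/
@[route_item "route-AnomalousDissipation-PointSink", crux]
def ConeDesingularisation : Prop :=
  PointFluxCone → ∃ (Q : EuclideanSpace ℝ (Fin 3) → EuclideanSpace ℝ (Fin 3)) (P : EuclideanSpace ℝ (Fin 3) → ℝ), Literature.Analysis.FluidPDE.IsClassicalNSSolutionOn Set.univ 1 (fun _ _ => 0) (fun _ => Q) (fun _ => P) ∧ (∃ C : ℝ, ∀ R : ℝ, 1 ≤ R → ∫ x in Metric.ball (0 : EuclideanSpace ℝ (Fin 3)) R, ‖Q x‖ ^ 2 ≤ C * R ^ (5 / 3 : ℝ)) ∧ MeasureTheory.Integrable (fun x => Literature.Analysis.FluidPDE.frobeniusNormSq (fderiv ℝ Q x)) ∧ 0 < ∫ x, Literature.Analysis.FluidPDE.frobeniusNormSq (fderiv ℝ Q x) ∧ ∃ (lam : ℝ) (V : EuclideanSpace ℝ (Fin 3) → EuclideanSpace ℝ (Fin 3)), 1 < lam ∧ MeasureTheory.AEStronglyMeasurable V MeasureTheory.volume ∧ (∀ x : EuclideanSpace ℝ (Fin 3), x ≠ 0 → V (lam • x) = lam ^ (-(2 / 3 : ℝ))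 • V x) ∧ MeasureTheory.LocallyIntegrableOn (fun x => ‖V x‖ ^ 2) {x : EuclideanSpace ℝ (Fin 3) | x ≠ 0} MeasureTheory.volume ∧ 0 < ∫ x in {x : EuclideanSpace ℝ (Fin 3) | 1 < ‖x‖ ∧ ‖x‖ < lam}, ‖V x‖ ^ 2 ∧ Filter.Tendsto (fun k : ℕ => (lam ^ k) ^ (-(5 / 3 : ℝ)) * ∫ x in {x : EuclideanSpace ℝ (Fin 3) | lam ^ k < ‖x‖ ∧ ‖x‖ < lam ^ (k + 1)}, ‖Q x - V x‖ ^ 2) Filter.atTop (nhds 0)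

/-- item stmt-AnomalousDissipation-19035 · crux · rank 4 · open · by planner
why it might fail: Constant-strength singular rays of the cone cannot end under a smooth f (Bernoulli pairing kills C¹-off-a-point sinks; a rough completion must be Euler-compatible), and the outer linearised steady Euler operator is not Fredholm: small-ν steady states near a designed Euler flow may not exist.
sources: arXiv:1803.00066, arXiv:0711.0560, arXiv:1811.01089, doi:10.1137/140957354, arXiv:2405.08390, Ideas/_closed/bernoulli-poincare-thin-set-liouville.md (card K1 SteadySkeletonNoWork: the C¹-off-thin-set obstruction)
[crux] SOLITON TRANSPLANT: if a cascade soliton exists then the point-sink zeroth law X holds on T³.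
Intended construction (birth skeleton): (1) SINK COMPLETION — choose a sink x₀, an amplitude A and a
steady weak Euler field U ∈ L²(T³), equal to the rescaled cone A·V on a punctured ball around x₀ and
completed OUTSIDE it by a field of our design, with the smooth stirring f := the Euler residual of
the completion (smooth because the singular part is exactly Euler near x₀ and its pressure gradient
is Leray-projected away; the cone's roughness must be closed up Euler-compatibly inside the stirring
region — the geometric content); ∫ f·U = A³ × (cone flux) > 0 is the anomalous work; (2) VISCOUS
REALISATION — along the DSS viscosity sequence ν_k = A λ^{-k/3} (so that μ_k = (A/ν_k)³ = λ^k
matches the far-field period exactly) glue the exact soliton family ν_k μ_k Q(μ_k(x − x₀)) into U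
and correct to exact steady NS_{ν_k} states by an inner–outer Lyapunov–Schmidt scheme around a KNOWN
core (the soliton's linearisation, modulo translations and scaling) and a designed outer flow;
dissipation ≥ A³∫|∇Q|²/2, energy ≤ 2∫|U|², concentration from the core scaling. The force f is
ν-independent by -/
@[route_item "route-AnomalousDissipation-PointSink", crux]
def SolitonTransplant : Prop :=
  (∃ (Q : EuclideanSpace ℝ (Fin 3) → EuclideanSpace ℝ (Fin 3)) (P : EuclideanSpace ℝ (Fin 3) → ℝ), Literature.Analysis.FluidPDE.IsClassicalNSSolutionOn Set.univ 1 (fun _ _ => 0) (fun _ => Q) (fun _ => P) ∧ (∃ C : ℝ, ∀ R : ℝ, 1 ≤ R → ∫ x in Metric.ball (0 : EuclideanSpace ℝ (Fin 3)) R, ‖Q x‖ ^ 2 ≤ C * R ^ (5 / 3 : ℝ)) ∧ MeasureTheory.Integrable (fun x => Literature.Analysis.FluidPDE.frobeniusNormSq (fderiv ℝ Q x)) ∧ 0 < ∫ x, Literature.Analysis.FluidPDE.frobeniusNormSq (fderiv ℝ Q x) ∧ ∃ (lam : ℝ) (V : EuclideanSpace ℝ (Fin 3) → EuclideanSpace ℝ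 (Fin 3)), 1 < lam ∧ MeasureTheory.AEStronglyMeasurable V MeasureTheory.volume ∧ (∀ x : EuclideanSpace ℝ (Fin 3), x ≠ 0 → V (lam • x) = lam ^ (-(2 / 3 : ℝ)) • V x) ∧ MeasureTheory.LocallyIntegrableOn (fun x => ‖V x‖ ^ 2) {x : EuclideanSpace ℝ (Fin 3) | x ≠ 0} MeasureTheory.volume ∧ 0 < ∫ x in {x : EuclideanSpace ℝ (Fin 3) | 1 < ‖x‖ ∧ ‖x‖ < lam}, ‖V x‖ ^ 2 ∧ Filter.Tendsto (fun k : ℕ => (lam ^ k) ^ (-(5 / 3 : ℝ)) * ∫ x in {x : EuclideanSpace ℝ (Fin 3) | lam ^ k < ‖x‖ ∧ ‖x‖ < lam ^ (k + 1)}, ‖Q x - V x‖ ^ 2) Filter.atTop (nhds 0)) → PointSinkZerothLaw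

/-- item stmt-AnomalousDissipation-19036 · support · rank 9 · open · by planner
sources: Galdi2011, arXiv:2608.06040, 2001 ns-neg theory-t1 WALL-REQUEST-1, Theses/NavierStokesRegularity DSolutionBubble.lean stmt-NavierStokesRegularity-0898
[support] NODE statement of the chain (the 2001 wall `cascade-soliton` verbatim in L²-mass form +
DSS far field): ∃ smooth steady unforced unit-viscosity NS solution (Q, P) on ℝ³ with sup_{R≥1}
R^{-5/3}∫_{B_R}|Q|² < ∞, 0 < ∫|∇Q|² < ∞, and a non-trivial measurable locally-L² discretely
self-similar far field V (V(λx) = λ^{-2/3}V(x)) with λ^{-5k/3}∫_{shell k}|Q − V|² → 0. Filed as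
support so that it is a decl the two cruxes around it can name; proving it outright discharges
PointFluxCone and ConeDesingularisation at once (then `closes` needs only SolitonTransplant). Its
W_pt subclass (pointwise envelope with |∇Q| = O(r^{-5/3}), p → 0) is exactly
¬GaldiLiouvilleGate.CriticalRateLiouville on the NS summit. [difficulty: open-problem] -/
@[route_item "route-AnomalousDissipation-PointSink"]
def CascadeSoliton : Prop :=
  ∃ (Q : EuclideanSpace ℝ (Fin 3) → EuclideanSpace ℝ (Fin 3)) (P : EuclideanSpace ℝ (Fin 3) → ℝ), Literature.Analysis.FluidPDE.IsClassicalNSSolutionOn Set.univ 1 (fun _ _ => 0) (fun _ => Q) (fun _ => P) ∧ (∃ C : ℝ, ∀ R : ℝ, 1 ≤ R → ∫ x in Metric.ball (0 : EuclideanSpace ℝ (Fin 3)) R, ‖Q x‖ ^ 2 ≤ C * R ^ (5 / 3 : ℝ)) ∧ MeasureTheory.Integrable (fun x => Literature.Analysis.FluidPDE.frobeniusNormSq (fderiv ℝ Q x)) ∧ 0 < ∫ x, Literature.Analysis.FluidPDE.frobeniusNormSq (fderiv ℝ Q x) ∧ ∃ (lam : ℝ) (V : EuclideanSpace ℝ (Fin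 3) → EuclideanSpace ℝ (Fin 3)), 1 < lam ∧ MeasureTheory.AEStronglyMeasurable V MeasureTheory.volume ∧ (∀ x : EuclideanSpace ℝ (Fin 3), x ≠ 0 → V (lam • x) = lam ^ (-(2 / 3 : ℝ)) • V x) ∧ MeasureTheory.LocallyIntegrableOn (fun x => ‖V x‖ ^ 2) {x : EuclideanSpace ℝ (Fin 3) | x ≠ 0} MeasureTheory.volume ∧ 0 < ∫ x in {x : EuclideanSpace ℝ (Fin 3) | 1 < ‖x‖ ∧ ‖x‖ < lam}, ‖V x‖ ^ 2 ∧ Filter.Tendsto (fun k : ℕ => (lam ^ k) ^ (-(5 / 3 : ℝ)) * ∫ x in {x : EuclideanSpace ℝ (Fin 3) | lam ^ k < ‖x‖ ∧ ‖x‖ < lam ^ (k + 1)}, ‖Q x - V x‖ ^ 2) Filter.atTop (nhds 0)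

/-- item stmt-AnomalousDissipation-19037 · support · rank 9 · open · by planner
sources: Frisch1995, DoeringFoias2002, Literature.Analysis.FluidPDE.IsSuitableWeakSolutionOn.stRescale (tree covariance lemmas used by HomogeneousForceArena)
[support] THE FREE-SPACE ZEROTH LAW (provable now, pure change of variables; the sanity identity
behind the whole line): for every C¹ field Q on ℝ³ with integrable |∇Q|² and the envelope
∫_{B_R}|Q|² ≤ C R^{5/3} (R ≥ 1), and every 0 < ν ≤ 1, the rescaled field u_ν(y) = ν^{-2} Q(ν^{-3} y)
satisfies ν ∫ |∇u_ν|² = ∫ |∇Q|² (ν-INDEPENDENT dissipation) and ∫_{B_1}|u_ν|² ≤ C (bounded energy in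
the unit ball). With Q a steady NS solution at viscosity 1, u_ν is a steady NS solution at viscosity
ν (same scaling), so a cascade soliton IS a fixed-point zeroth-law family on ℝ³ fed from infinity.
~150 lines: fderiv of y ↦ a•Q(b•y), frobeniusNormSq homogeneity, MeasureTheory.integral_comp_smul,
Measure.addHaar_ball scaling. [difficulty: provable-now] -/
@[route_item "route-AnomalousDissipation-PointSink"]
def FreeSpaceZerothLaw : Prop :=
  ∀ (Q : EuclideanSpace ℝ (Fin 3) → EuclideanSpace ℝ (Fin 3)), ContDiff ℝ 1 Q → MeasureTheory.Integrable (fun x => Literature.Analysis.FluidPDE.frobeniusNormSq (fderiv ℝ Q x)) → ∀ C : ℝ, (∀ R : ℝ, 1 ≤ R → ∫ x in Metric.ball (0 : EuclideanSpace ℝ (Fin 3)) R, ‖Q x‖ ^ 2 ≤ C * R ^ (5 / 3 : ℝ)) → ∀ ν : ℝ, 0 < ν → ν ≤ 1 → (ν * ∫ x, Literature.Analysis.FluidPDE.frobeniusNormSq (fderiv ℝ (fun y => (ν * ν⁻¹ ^ (3 : ℕ)) • Q (ν⁻¹ ^ (3 : ℕ) • y)) x) = ∫ x, Literature.Analysis.FluidPDE.frobeniusNormSq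 (fderiv ℝ Q x)) ∧ ∫ x in Metric.ball (0 : EuclideanSpace ℝ (Fin 3)) 1, ‖(ν * ν⁻¹ ^ (3 : ℕ)) • Q (ν⁻¹ ^ (3 : ℕ) • x)‖ ^ 2 ≤ C

/-- item stmt-AnomalousDissipation-19038 · assembly · rank 1 · open · by planner
sources: DoeringFoias2002, Theorems/CoherentStatesSteadyImpliesCoherent.lean, Theorems/CoherentStatesAssembly.lean
[assembly] PointFluxCone → ConeDesingularisation → SolitonTransplant → AnomalousDissipation (the
deciding theorem's type; proved as `assembly_holds` in Sketch.lean from `closes`). -/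
@[route_item "route-AnomalousDissipation-PointSink"]
def Assembly : Prop :=
  PointFluxCone → ConeDesingularisation → SolitonTransplant → AnomalousDissipation

/-! D-0027 §2.1 — DECIDING THEOREM (planner-authored via `route open/edit --closes-file`; by planner-plan-lens3-AnomalousDissipation-resurrect-g2-0 2026-08-17T03:14:21Z):
its hypotheses are this route's items and its conclusion the sub-problem Statement (glue_lint), and it elaborates with this file. -/

@[closes "route-AnomalousDissipation-PointSink"] theorem closes (h₁ : PointFluxCone) (h₂ : ConeDesingularisation) (h₃ : SolitonTransplant) : _root_.AnomalousDissipation := by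
  obtain ⟨f, hf, hdiv, hmean, x₀, ν, u, p, hν, hν0, hsol, hE, ⟨ε, hε, hεle⟩, _⟩ := h₃ (h₂ h₁)
  have hS : Summit.AnomalousDissipation.AnomalousDissipation.Theses.CoherentStates.SteadyZerothLaw :=
    ⟨f, hf, hdiv, hmean, ν, u, p, hν, hν0, hsol, hE, ε, hε, hεle⟩
  have hC : Summit.AnomalousDissipation.AnomalousDissipation.Theses.CoherentStates.CoherentThesis :=
    (show Summit.AnomalousDissipation.AnomalousDissipation.Theses.CoherentStates.SteadyZerothLaw →
        Summit.AnomalousDissipation.AnomalousDissipation.Theses.CoherentStates.CoherentThesis from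
      Summit.AnomalousDissipation.AnomalousDissipation.Theorems.steadyImpliesCoherent_proof) hS
  exact (show Summit.AnomalousDissipation.AnomalousDissipation.Theses.CoherentStates.CoherentThesis →
        Summit.AnomalousDissipation.AnomalousDissipation.Theses.CoherentStates.ClassicalGlobalIsGlobalLerayHopf →
        _root_.AnomalousDissipation from
      Summit.AnomalousDissipation.AnomalousDissipation.Theorems.coherentStatesAssembly_proof) hC
    Summit.AnomalousDissipation.AnomalousDissipation.Theorems.classicalGlobalIsGlobalLerayHopf_proof

end Summit.AnomalousDissipation.AnomalousDissipation.Theses.PointSink
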